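import Literature.NumberTheory.EllipticCurves.PAdicLFunctionMuInvariantCertificateProofs
import Mathlib.Data.Nat.Choose.Lucas
import HarnessLib

/-!
# Route `EisensteinPrimes`, crux 3 `MazurMCOnCellB` (stmt-BirchSwinnertonDyer-19033), line `mudescent`, μ-lineage
# (stub 3′ `stub_muPart_offLocus`): the Gauss norm of the Mazur–Tate–Teitelbaum transform IS the sup norm of
# the Teichmüller-orbit sums — with NO bound on the cells (helper; theorems only, no definition, no named fact)

Mazur–Tate–Teitelbaum (Invent. Math. 84 (1986), §I.11–I.13): a bounded distribution `μ` on the tower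
`(ℤ/pⁿ)_n` has the transform `∑_k c_k T^k`, `c_k = lim_n RS(k,n)`, `RS(k,n) = ∑_{s mod pⁿ} ν_n(s)·(s choose k)`
with the **Teichmüller-orbit sums** `ν_n(s) = ∑_η μ(η γˢ + p^{n+e₀}ℤ_p)` — the cells of the push-forward of
`μ|_{ℤ_p^×}` to `Γ = γ^{ℤ_p}` (the `ω⁰`-branch; tree `riemannSum_eq_sum_orbitSum_mul_choose`). Since
`ℤ_p⟦T⟧ ≅ ℤ_p⟦Γ⟧` isometrically (Mahler/Amice; Washington §7.1, §12.2), `sup_k ‖c_k‖ = sup_{n,s} ‖ν_n(s)‖`.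
The tree's certificate files (`PAdicLFunctionMuInvariantCertificateProofs` §1–§2,
`PAdicLFunctionRiemannSumCongruenceCertificateProofs`, `PAdicLFunctionBranchMuCertificateProofs`, the
`X11a.MuCoset` door) prove the two inequalities only up to the bound `C` of the CELLS `μ(a + pⁿℤ_p)`
(congruence `‖c_k − RS(k,n)‖ ≤ C·p⁻¹`) — useless when the cells are not `p`-integral although the orbit sums
are, the situation of a Néron-normalised plus-symbol measure at a REDUCIBLE prime (`[0]⁺ = L(E,1)/Ω_E` with
`p` in the denominator, e.g. `11a3 @ 5`; the X2b étale ends of crux `MazurMCOnCellB`). This file proves the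
isometry itself: §0 tools (Lucas below degree `pⁿ`, Newton inversion — private upstream, re-proved); §1 the
SHARP congruence `‖c_k − RS(k,n)‖ ≤ V·p⁻¹` with `V = sup ‖ν‖` (`norm_sub_riemannSum_le_of_forall_norm_orbit_le`:
the binomial difference only depends on the `γ`-exponent, so the cells of one orbit enter through their
sum); §2 `norm_lim_le_of_forall_norm_orbit_le` (`sup ‖c‖ ≤ sup ‖ν‖`), `norm_orbit_le_of_forall_norm_lim_le`
(`sup ‖ν‖ ≤ sup ‖c‖`: `‖ν‖ ≤ max(B, V p^{-j})` for every `j` by induction), and the certificate criterion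
`exists_lt_norm_lim_iff_exists_lt_norm_orbit`: for every `B ≥ 0`, «some `‖c_k‖ > B`» ⟺ «some `‖ν_n(s)‖ > B`».

Use (cell `bsd-eis`, seat bsd-line-x2-p1-w2 g3, `--supports` stmt-BirchSwinnertonDyer-19033): route-independent
`p`-adic analysis, filed next to its consumer `Theorems/EisensteinPrimesX2AnalyticMuOrbitSum`, which reads the typed `X2.AnalyticMuLE W p m` at an odd
multiplicative prime (both signs) EXACTLY as «some Néron-normalised orbit sum `ϖ·∑_η [ηu/pⁿ]⁺_f`, `n ≥ 1`, has
norm `> p^{-(m+1)}`», with no integrality / `‖L(E,1)/Ω_E‖_p ≤ 1` / irreducibility hypothesis. HONEST FRAMING: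
`p`-adic analysis folklore made kernel; nothing about any curve is asserted; beyond-print theorem: no.

## References

* B. Mazur, J. Tate, J. Teitelbaum, *On `p`-adic analogues of the conjectures of Birch and
  Swinnerton-Dyer*, Invent. Math. 84 (1986), §I.11–I.13.
* L. C. Washington, *Introduction to cyclotomic fields*, GTM 83, §7.1 (`Λ ≅ ℤ_p⟦Γ⟧`), §12.2 (measures);
  Y. Amice, *Interpolation `p`-adique*, Bull. SMF 92 (1964), §1 (Mahler expansion and the sup norm).
-/

noncomputable section
open Filter Topology
open scoped fwdDiff
set_option linter.dupNamespace false -- summit and sub-problem share a name (D-0017 layout)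

namespace Summit.BirchSwinnertonDyer.BirchSwinnertonDyer.Theorems.EisensteinPrimesX2OrbitSupNorm

open Literature.NumberTheory.EllipticCurves

variable {p : ℕ} [Fact p.Prime]

/-! ### §0 Tools: Lucas below degree `pⁿ`, Newton inversion below degree `pⁿ` -/

section Tools

omit [Fact p.Prime] in
/-- Base-`p` digits below `n` only depend on `x mod pⁿ`. [folklore] -/
private theorem div_pow_mod_eq_of_modEq_pow' {x y n i : ℕ} (h : x ≡ y [MOD p ^ n]) (hi : i < n) :
    x / p ^ i % p = y / p ^ i % p := by
  have h' : x % (p ^ i * p) = y % (p ^ i * p) := by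
    rw [← pow_succ]
    exact Nat.ModEq.of_dvd (pow_dvd_pow p hi) h
  rw [← Nat.mod_mul_right_div_self, ← Nat.mod_mul_right_div_self, h']

/-- **Lucas**: `x ≡ y (mod pⁿ)`, `k < pⁿ` ⟹ `(x choose k) ≡ (y choose k) (mod p)` (private upstream in
`PAdicLFunctionRiemannSumCongruenceCertificateProofs`, re-proved). [folklore] -/
private theorem intCast_choose_modEq_of_modEq_pow_of_lt' {x y n k : ℕ} (h : x ≡ y [MOD p ^ n])
    (hk : k < p ^ n) : ((x.choose k : ℕ) : ℤ) ≡ ((y.choose k : ℕ) : ℤ) [ZMOD p] := by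
  have hx := Choose.choose_modEq_choose_mul_prod_range_choose (n := x) (k := k) (p := p) n
  have hy := Choose.choose_modEq_choose_mul_prod_range_choose (n := y) (k := k) (p := p) n
  rw [Nat.div_eq_of_lt hk, Nat.choose_zero_right, Nat.cast_one, one_mul] at hx hy
  have hprod : ∏ i ∈ Finset.range n, (x / p ^ i % p).choose (k / p ^ i % p) =
      ∏ i ∈ Finset.range n, (y / p ^ i % p).choose (k / p ^ i % p) :=
    Finset.prod_congr rfl fun i hi ↦ by rw [div_pow_mod_eq_of_modEq_pow' h (Finset.mem_range.mp hi)]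
  rw [hprod] at hx
  exact hx.trans hy.symm

/-- `‖(x choose k) − (y choose k)‖_p ≤ p⁻¹` for `x ≡ y (mod pⁿ)`, `k < pⁿ`. [folklore] -/
theorem norm_natCast_choose_sub_choose_le_inv_of_modEq_of_lt {x y n k : ℕ} (h : x ≡ y [MOD p ^ n])
    (hk : k < p ^ n) : ‖((x.choose k : ℕ) : ℚ_[p]) - (y.choose k : ℕ)‖ ≤ (p : ℝ)⁻¹ := by
  have hdvd : (p : ℤ) ∣ ((x.choose k : ℕ) : ℤ) - ((y.choose k : ℕ) : ℤ) :=
    (intCast_choose_modEq_of_modEq_pow_of_lt' h hk).symm.dvd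
  have hcast : ((x.choose k : ℕ) : ℚ_[p]) - (y.choose k : ℕ) =
      ((((x.choose k : ℕ) : ℤ) - ((y.choose k : ℕ) : ℤ) : ℤ) : ℚ_[p]) := by push_cast; rfl
  rw [hcast, ← zpow_neg_one]
  exact (Padic.norm_int_le_pow_iff_dvd _ 1).mpr (by rwa [pow_one])

/-- `‖x − y‖ ≤ max ‖x‖ ‖y‖` in `ℚ_p`. [folklore] -/
private theorem norm_sub_le_max' (x y : ℚ_[p]) : ‖x - y‖ ≤ max ‖x‖ ‖y‖ := by
  rw [sub_eq_add_neg, ← norm_neg y]; exact IsUltrametricDist.norm_add_le_max _ _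

/-- Iterated forward differences of a function with values in a ball of `ℚ_p` stay in that ball. [folklore] -/
private theorem norm_fwdDiff_iter_le' {g : ℕ → ℚ_[p]} {B : ℝ} (hg : ∀ x, ‖g x‖ ≤ B) (k x : ℕ) :
    ‖(Δ_[1])^[k] g x‖ ≤ B := by
  induction k generalizing x with
  | zero => simpa using hg x
  | succ k ih =>
    rw [Function.iterate_succ', Function.comp_apply]
    show ‖(Δ_[1])^[k] g (x + 1) - (Δ_[1])^[k] g x‖ ≤ B
    exact (norm_sub_le_max' _ _).trans (max_le (ih _) (ih _))

/-- **Newton inversion below degree `pⁿ`** (private upstream, re-proved): if all `∑_s ν(s)·(s choose k)`,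
`k < pⁿ`, have norm `≤ B` then so does every `ν(s)` (Gregory–Newton with INTEGER coefficients). [folklore] -/
theorem norm_le_of_forall_norm_sum_mul_choose_le' {n : ℕ} (ν : ZMod (p ^ n) → ℚ_[p]) {B : ℝ}
    (hB : ∀ k < p ^ n, ‖∑ s : ZMod (p ^ n), ν s * ((s.val.choose k : ℕ) : ℚ_[p])‖ ≤ B)
    (s₀ : ZMod (p ^ n)) : ‖ν s₀‖ ≤ B := by
  classical
  haveI : NeZero (p ^ n) := ⟨pow_ne_zero _ (Fact.out : p.Prime).ne_zero⟩
  have hB0 : 0 ≤ B := (norm_nonneg _).trans (hB 0 (pow_pos (Fact.out : p.Prime).pos n))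
  set g : ℕ → ℚ_[p] := fun x ↦ if x = s₀.val then 1 else 0 with hg_def
  set b : ℕ → ℚ_[p] := fun k ↦ (Δ_[1])^[k] g 0 with hb_def
  have hg1 : ∀ x, ‖g x‖ ≤ 1 := fun x ↦ by
    rw [hg_def]; dsimp only; split_ifs <;> simp
  have hb : ∀ k, ‖b k‖ ≤ 1 := fun k ↦ norm_fwdDiff_iter_le' hg1 k 0
  have hnewton : ∀ x : ℕ, g x = ∑ k ∈ Finset.range (x + 1), ((x.choose k : ℕ) : ℚ_[p]) * b k := by
    intro x
    have h := shift_eq_sum_fwdDiff_iter (1 : ℕ) g x 0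
    rw [zero_add, smul_eq_mul, mul_one] at h
    rw [h]
    refine Finset.sum_congr rfl fun k _ ↦ ?_
    rw [hb_def, nsmul_eq_mul]
  have hnewton' : ∀ s : ZMod (p ^ n),
      g s.val = ∑ k ∈ Finset.range (p ^ n), ((s.val.choose k : ℕ) : ℚ_[p]) * b k := by
    intro s
    rw [hnewton s.val]
    refine Finset.sum_subset (Finset.range_mono (Nat.succ_le_of_lt (ZMod.val_lt s))) ?_
    intro k _ hk'
    rw [Finset.mem_range, not_lt] at hk'
    rw [Nat.choose_eq_zero_of_lt (Nat.lt_of_succ_le hk'), Nat.cast_zero, zero_mul]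
  have hkey : ν s₀ = ∑ k ∈ Finset.range (p ^ n),
      b k * ∑ s : ZMod (p ^ n), ν s * ((s.val.choose k : ℕ) : ℚ_[p]) := by
    calc ν s₀ = ∑ s : ZMod (p ^ n), ν s * g s.val := by
          rw [Finset.sum_eq_single s₀]
          · rw [hg_def]; simp
          · intro s _ hs
            have : s.val ≠ s₀.val := fun h ↦ hs (ZMod.val_injective _ h)
            rw [hg_def]; simp [this]
          · intro h; exact absurd (Finset.mem_univ s₀) h
      _ = ∑ s : ZMod (p ^ n), ∑ k ∈ Finset.range (p ^ n),
            ν s * (((s.val.choose k : ℕ) : ℚ_[p]) * b k) := by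
          refine Finset.sum_congr rfl fun s _ ↦ ?_
          rw [hnewton' s, Finset.mul_sum]
      _ = ∑ k ∈ Finset.range (p ^ n), ∑ s : ZMod (p ^ n),
            ν s * (((s.val.choose k : ℕ) : ℚ_[p]) * b k) := Finset.sum_comm
      _ = ∑ k ∈ Finset.range (p ^ n),
            b k * ∑ s : ZMod (p ^ n), ν s * ((s.val.choose k : ℕ) : ℚ_[p]) := by
          refine Finset.sum_congr rfl fun k _ ↦ ?_
          rw [Finset.mul_sum]
          refine Finset.sum_congr rfl fun s _ ↦ ?_
          ring
  rw [hkey]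
  refine IsUltrametricDist.norm_sum_le_of_forall_le_of_nonneg hB0 fun k hk ↦ ?_
  rw [norm_mul]
  calc ‖b k‖ * ‖∑ s : ZMod (p ^ n), ν s * ((s.val.choose k : ℕ) : ℚ_[p])‖ ≤ 1 * B :=
        mul_le_mul (hb k) (hB k (Finset.mem_range.mp hk)) (norm_nonneg _) zero_le_one
    _ = B := one_mul B

end Tools

/-! ### §1 The sharp congruence: Riemann sums below degree `pⁿ` are constant modulo `(sup ‖ν‖)·p⁻¹` -/

section OrbitSup

variable {μ : (n : ℕ) → ZMod (p ^ n) → ℚ_[p]} {RS : ℕ → ℕ → ℚ_[p]}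
  {ν : (n : ℕ) → ZMod (p ^ n) → ℚ_[p]}
  (hRS : ∀ k n : ℕ, RS k n =
      ∑ᶠ ξ : rootsOfUnity (torsionOrder p) ℤ_[p], ∑ s : ZMod (p ^ n),
        μ (n + cyclotomicExponent p)
            (PadicInt.toZModPow (n + cyclotomicExponent p) ((ξ : ℤ_[p]ˣ) : ℤ_[p]) *
              (cyclotomicGenerator p : ZMod (p ^ (n + cyclotomicExponent p))) ^ s.val) *
          ((s.val.choose k : ℕ) : ℚ_[p]))
  (hν : ∀ (n : ℕ) (s : ZMod (p ^ n)), ν n s =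
      ∑ᶠ ξ : rootsOfUnity (torsionOrder p) ℤ_[p],
        μ (n + cyclotomicExponent p)
          (PadicInt.toZModPow (n + cyclotomicExponent p) ((ξ : ℤ_[p]ˣ) : ℤ_[p]) *
            (cyclotomicGenerator p : ZMod (p ^ (n + cyclotomicExponent p))) ^ s.val))

include hν
/-- **The orbit sums of a bounded `μ` are bounded by the same constant** (ultrametric). [folklore] -/
theorem norm_orbit_le_of_forall_norm_le {C : ℝ} (hC : ∀ (n : ℕ) (a : ZMod (p ^ n)), ‖μ n a‖ ≤ C)
    (n : ℕ) (s : ZMod (p ^ n)) : ‖ν n s‖ ≤ C := by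
  classical
  haveI := neZero_torsionOrder p
  haveI := Fintype.ofFinite (rootsOfUnity (torsionOrder p) ℤ_[p])
  have hC0 : 0 ≤ C := (norm_nonneg _).trans (hC 0 0)
  rw [hν, finsum_eq_sum_of_fintype]
  exact IsUltrametricDist.norm_sum_le_of_forall_le_of_nonneg hC0 fun ξ _ ↦ hC _ _

/-- **Distribution relation of the orbit sums**: `∑_{s' ≡ s (pⁿ)} ν_{n+1}(s') = ν_n(s)` (tree:
`sum_fiber_orbitSum_succ_eq`). [cite: MazurTateTeitelbaum1986Invent, §I.11–I.13] -/
theorem sum_fiber_orbit_succ_eq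
    (hdist : ∀ (n : ℕ) (a : ZMod (p ^ n)),
      ∑ b ∈ Finset.univ.filter (fun b : ZMod (p ^ (n + 1)) ↦
        ZMod.castHom (pow_dvd_pow p n.le_succ) (ZMod (p ^ n)) b = a), μ (n + 1) b = μ n a)
    (n : ℕ) (s : ZMod (p ^ n)) :
    ∑ s' ∈ Finset.univ.filter (fun s' : ZMod (p ^ (n + 1)) ↦
        ZMod.castHom (pow_dvd_pow p n.le_succ) (ZMod (p ^ n)) s' = s), ν (n + 1) s' = ν n s := by
  simp only [hν]
  exact sum_fiber_orbitSum_succ_eq hdist n s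

include hRS
/-- **The Riemann sums regrouped over the `γ`-exponent**: `RS(k,n) = ∑_s ν_n(s)·(s choose k)` (tree:
`riemannSum_eq_sum_orbitSum_mul_choose`). [cite: MazurTateTeitelbaum1986Invent, §I.13] -/
theorem riemannSum_eq_sum_orbit_mul_choose (k n : ℕ) :
    RS k n = ∑ s : ZMod (p ^ n), ν n s * ((s.val.choose k : ℕ) : ℚ_[p]) := by
  rw [riemannSum_eq_sum_orbitSum_mul_choose hRS k n]
  simp only [hν]

/-- **The Riemann sums at ONE level are bounded by the sup of the orbit sums at that level** (the
binomial coefficients are integers; ultrametric). [folklore] -/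
theorem norm_riemannSum_le_of_forall_norm_orbit_le {n : ℕ} {V : ℝ} (hV0 : 0 ≤ V)
    (hV : ∀ s : ZMod (p ^ n), ‖ν n s‖ ≤ V) (k : ℕ) : ‖RS k n‖ ≤ V := by
  classical
  rw [riemannSum_eq_sum_orbit_mul_choose hRS hν k n]
  refine IsUltrametricDist.norm_sum_le_of_forall_le_of_nonneg hV0 fun s _ ↦ ?_
  have h := Padic.norm_int_le_one (p := p) ((s.val.choose k : ℕ) : ℤ)
  rw [Int.cast_natCast] at h
  rw [norm_mul]
  calc ‖ν n s‖ * ‖((s.val.choose k : ℕ) : ℚ_[p])‖ ≤ V * 1 :=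
        mul_le_mul (hV s) h (norm_nonneg _) hV0
    _ = V := mul_one V

/-- **One refinement step, bounded by the ORBIT sums**: with `‖ν_{n+1}(s')‖ ≤ V` and
`‖(x choose k) − (y choose k)‖ ≤ B` for `x ≡ y (mod pⁿ)`, `‖RS k (n+1) − RS k n‖ ≤ V·B` — an exponent
`s' mod p^{n+1}` contributes `ν_{n+1}(s')·((s' choose k) − (s' mod pⁿ choose k))`; the cells of one orbit enter
only through their SUM (the tree's `norm_riemannSum_succ_sub_le_of_forall_choose` bounds cell by cell).
[cite: MazurTateTeitelbaum1986Invent, §I.11–I.13] -/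
theorem norm_riemannSum_succ_sub_le_of_forall_norm_orbit_le
    (hdist : ∀ (n : ℕ) (a : ZMod (p ^ n)),
      ∑ b ∈ Finset.univ.filter (fun b : ZMod (p ^ (n + 1)) ↦
        ZMod.castHom (pow_dvd_pow p n.le_succ) (ZMod (p ^ n)) b = a), μ (n + 1) b = μ n a)
    (k n : ℕ) {V : ℝ} (hV0 : 0 ≤ V) (hV : ∀ s' : ZMod (p ^ (n + 1)), ‖ν (n + 1) s'‖ ≤ V) {B : ℝ}
    (hB : ∀ x y : ℕ, x ≡ y [MOD p ^ n] → ‖((x.choose k : ℕ) : ℚ_[p]) - (y.choose k : ℕ)‖ ≤ B) :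
    ‖RS k (n + 1) - RS k n‖ ≤ V * B := by
  classical
  haveI : NeZero (p ^ n) := ⟨pow_ne_zero _ (Fact.out : p.Prime).ne_zero⟩
  haveI : NeZero (p ^ (n + 1)) := ⟨pow_ne_zero _ (Fact.out : p.Prime).ne_zero⟩
  set π : ZMod (p ^ (n + 1)) → ZMod (p ^ n) :=
    fun s' ↦ ZMod.castHom (pow_dvd_pow p n.le_succ) (ZMod (p ^ n)) s' with hπ_def
  have hπval : ∀ s' : ZMod (p ^ (n + 1)), (π s').val = s'.val % p ^ n := fun s' ↦ by
    rw [hπ_def]; dsimp only; rw [ZMod.castHom_apply, ZMod.cast_eq_val, ZMod.val_natCast]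
  -- refine `RS k n` to level `n + 1` along the orbit distribution relation
  have hrefine : RS k n =
      ∑ s' : ZMod (p ^ (n + 1)), ν (n + 1) s' * (((π s').val.choose k : ℕ) : ℚ_[p]) := by
    rw [riemannSum_eq_sum_orbit_mul_choose hRS hν k n]
    calc ∑ s : ZMod (p ^ n), ν n s * ((s.val.choose k : ℕ) : ℚ_[p])
        = ∑ s : ZMod (p ^ n), ∑ s' ∈ Finset.univ.filter (fun s' : ZMod (p ^ (n + 1)) ↦ π s' = s),
            ν (n + 1) s' * (((π s').val.choose k : ℕ) : ℚ_[p]) := by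
          refine Finset.sum_congr rfl fun s _ ↦ ?_
          rw [← sum_fiber_orbit_succ_eq hν hdist n s, Finset.sum_mul]
          refine Finset.sum_congr rfl fun s' hs' ↦ ?_
          have hs : π s' = s := (Finset.mem_filter.mp hs').2
          rw [hs]
      _ = ∑ s' : ZMod (p ^ (n + 1)), ν (n + 1) s' * (((π s').val.choose k : ℕ) : ℚ_[p]) :=
          Finset.sum_fiberwise Finset.univ π _
  have hB0 : 0 ≤ B := (norm_nonneg _).trans (hB 0 0 (Nat.ModEq.refl 0))
  rw [riemannSum_eq_sum_orbit_mul_choose hRS hν k (n + 1), hrefine, ← Finset.sum_sub_distrib]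
  refine IsUltrametricDist.norm_sum_le_of_forall_le_of_nonneg (mul_nonneg hV0 hB0) fun s' _ ↦ ?_
  have hmod : s'.val ≡ (π s').val [MOD p ^ n] := by rw [hπval]; exact (Nat.mod_modEq _ _).symm
  rw [← mul_sub, norm_mul]
  exact mul_le_mul (hV s') (hB _ _ hmod) (norm_nonneg _) hV0

/-- **The sharp congruence between levels**: for `k < pⁿ ≤ p^m` and `‖ν‖ ≤ V` at all levels,
`‖RS k m − RS k n‖ ≤ V·p⁻¹` (Lucas at each step; ultrametric). [cite: MazurTateTeitelbaum1986Invent, §I.12–I.13] -/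
theorem norm_riemannSum_sub_le_of_forall_norm_orbit_le
    (hdist : ∀ (n : ℕ) (a : ZMod (p ^ n)),
      ∑ b ∈ Finset.univ.filter (fun b : ZMod (p ^ (n + 1)) ↦
        ZMod.castHom (pow_dvd_pow p n.le_succ) (ZMod (p ^ n)) b = a), μ (n + 1) b = μ n a)
    {V : ℝ} (hV0 : 0 ≤ V) (hV : ∀ (m : ℕ) (s : ZMod (p ^ m)), ‖ν m s‖ ≤ V) {k n : ℕ}
    (hk : k < p ^ n) {m : ℕ} (hnm : n ≤ m) :
    ‖RS k m - RS k n‖ ≤ V * (p : ℝ)⁻¹ := by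
  induction m, hnm using Nat.le_induction with
  | base => rw [sub_self, norm_zero]; positivity
  | succ m hnm ih =>
    have hkm : k < p ^ m := hk.trans_le (Nat.pow_le_pow_right (Fact.out : p.Prime).pos hnm)
    have hstep : ‖RS k (m + 1) - RS k m‖ ≤ V * (p : ℝ)⁻¹ :=
      norm_riemannSum_succ_sub_le_of_forall_norm_orbit_le hRS hν hdist k m hV0 (hV (m + 1))
        fun x y hxy ↦ norm_natCast_choose_sub_choose_le_inv_of_modEq_of_lt hxy hkm
    calc ‖RS k (m + 1) - RS k n‖ = ‖(RS k (m + 1) - RS k m) + (RS k m - RS k n)‖ := by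
          rw [sub_add_sub_cancel]
      _ ≤ max ‖RS k (m + 1) - RS k m‖ ‖RS k m - RS k n‖ := IsUltrametricDist.norm_add_le_max _ _
      _ ≤ V * (p : ℝ)⁻¹ := max_le hstep ih

/-- **The sharp congruence for the coefficients**: if `RS k · → c` and `k < pⁿ`, then
`‖c − RS k n‖ ≤ V·p⁻¹` with `V` ANY bound of the orbit sums (closed balls are closed).
[cite: MazurTateTeitelbaum1986Invent, §I.12–I.13] -/
theorem norm_sub_riemannSum_le_of_forall_norm_orbit_le
    (hdist : ∀ (n : ℕ) (a : ZMod (p ^ n)),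
      ∑ b ∈ Finset.univ.filter (fun b : ZMod (p ^ (n + 1)) ↦
        ZMod.castHom (pow_dvd_pow p n.le_succ) (ZMod (p ^ n)) b = a), μ (n + 1) b = μ n a)
    {V : ℝ} (hV0 : 0 ≤ V) (hV : ∀ (m : ℕ) (s : ZMod (p ^ m)), ‖ν m s‖ ≤ V) {k n : ℕ}
    (hk : k < p ^ n) {c : ℚ_[p]} (hc : Tendsto (fun m ↦ RS k m) atTop (𝓝 c)) :
    ‖c - RS k n‖ ≤ V * (p : ℝ)⁻¹ := by
  refine le_of_tendsto (hc.sub tendsto_const_nhds).norm ?_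
  filter_upwards [eventually_ge_atTop n] with m hm
  exact norm_riemannSum_sub_le_of_forall_norm_orbit_le hRS hν hdist hV0 hV hk hm

/-! ### §2 The isometry `sup_k ‖c_k‖ = sup_{n,s} ‖ν_n(s)‖` -/

/-- **Newton inversion at level `n`**: if every `‖RS k n‖ ≤ B` for `k < pⁿ` then every `‖ν_n(s)‖ ≤ B`.
[folklore] -/
theorem norm_orbit_le_of_forall_norm_riemannSum_le {n : ℕ} {B : ℝ}
    (hB : ∀ k < p ^ n, ‖RS k n‖ ≤ B) (s : ZMod (p ^ n)) : ‖ν n s‖ ≤ B :=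
  norm_le_of_forall_norm_sum_mul_choose_le' (ν n)
    (fun k hk ↦ by rw [← riemannSum_eq_sum_orbit_mul_choose hRS hν k n]; exact hB k hk) s

/-- **`sup ‖c‖ ≤ sup ‖ν‖`** (the easy half of the isometry): a coefficient `c = lim_m RS k m` has
norm `≤ V` as soon as all orbit sums do. [cite: Washington1997, §7.1] -/
theorem norm_lim_le_of_forall_norm_orbit_le {V : ℝ} (hV0 : 0 ≤ V)
    (hV : ∀ (m : ℕ) (s : ZMod (p ^ m)), ‖ν m s‖ ≤ V) {k : ℕ} {c : ℚ_[p]}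
    (hc : Tendsto (fun m ↦ RS k m) atTop (𝓝 c)) : ‖c‖ ≤ V :=
  le_of_tendsto hc.norm (Eventually.of_forall fun m ↦
    norm_riemannSum_le_of_forall_norm_orbit_le hRS hν hV0 (hV m) k)

/-- **`sup ‖ν‖ ≤ sup ‖c‖`** (the hard half of the isometry — Amice/Mahler): if `μ` satisfies the
distribution relation, `‖ν‖ ≤ V`, `RS k · → c_k` and every `‖c_k‖ ≤ B` (`B ≥ 0`), then every `‖ν_n(s)‖ ≤ B`.
Proof: `‖ν‖ ≤ max(B, V·p^{-j})` for every `j` by induction (sharp congruence with the current bound, then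
Newton inversion), and `V·p^{-j} → 0`. [cite: Washington1997, §7.1 and §12.2] [cite: MazurTateTeitelbaum1986Invent, §I.12–I.13] -/
theorem norm_orbit_le_of_forall_norm_lim_le
    (hdist : ∀ (n : ℕ) (a : ZMod (p ^ n)),
      ∑ b ∈ Finset.univ.filter (fun b : ZMod (p ^ (n + 1)) ↦
        ZMod.castHom (pow_dvd_pow p n.le_succ) (ZMod (p ^ n)) b = a), μ (n + 1) b = μ n a)
    {V : ℝ} (hV : ∀ (m : ℕ) (s : ZMod (p ^ m)), ‖ν m s‖ ≤ V)
    {c : ℕ → ℚ_[p]} (hc : ∀ k : ℕ, Tendsto (fun m ↦ RS k m) atTop (𝓝 (c k)))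
    {B : ℝ} (hB0 : 0 ≤ B) (hB : ∀ k : ℕ, ‖c k‖ ≤ B) (n : ℕ) (s : ZMod (p ^ n)) :
    ‖ν n s‖ ≤ B := by
  have hp1 : (1 : ℝ) < p := by exact_mod_cast (Fact.out : p.Prime).one_lt
  have hp0 : (0 : ℝ) < p := by positivity
  have hV0 : 0 ≤ V := (norm_nonneg _).trans (hV 0 0)
  -- `‖ν‖ ≤ max B (V / p^j)` for every `j`
  have key : ∀ j : ℕ, ∀ (m : ℕ) (t : ZMod (p ^ m)), ‖ν m t‖ ≤ max B (V * (p : ℝ)⁻¹ ^ j) := by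
    intro j
    induction j with
    | zero => intro m t; rw [pow_zero, mul_one]; exact le_max_of_le_right (hV m t)
    | succ j ih =>
      intro m t
      set M : ℝ := max B (V * (p : ℝ)⁻¹ ^ j) with hM_def
      have hM0 : 0 ≤ M := hB0.trans (le_max_left _ _)
      -- Riemann sums at level `m` below degree `p^m` are bounded by `max B (M p⁻¹)`
      have hRSle : ∀ k < p ^ m, ‖RS k m‖ ≤ max B (M * (p : ℝ)⁻¹) := by
        intro k hk
        have h1 : ‖c k - RS k m‖ ≤ M * (p : ℝ)⁻¹ :=
          norm_sub_riemannSum_le_of_forall_norm_orbit_le hRS hν hdist hM0 ih hk (hc k)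
        have h2 : RS k m = c k - (c k - RS k m) := by ring
        rw [h2]
        exact (norm_sub_le_max' _ _).trans (max_le_max (hB k) h1)
      have hνle : ‖ν m t‖ ≤ max B (M * (p : ℝ)⁻¹) :=
        norm_orbit_le_of_forall_norm_riemannSum_le hRS hν hRSle t
      refine hνle.trans (max_le (le_max_left _ _) ?_)
      -- `M p⁻¹ = max (B p⁻¹) (V p^{-(j+1)}) ≤ max B (V p^{-(j+1)})`
      rw [hM_def, max_mul_of_nonneg _ _ (inv_nonneg.mpr hp0.le)]
      refine max_le ?_ ?_
      · calc B * (p : ℝ)⁻¹ ≤ B * 1 := mul_le_mul_of_nonneg_left (inv_le_one_of_one_le₀ hp1.le) hB0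
          _ = B := mul_one B
          _ ≤ _ := le_max_left _ _
      · rw [mul_assoc, ← pow_succ]
        exact le_max_right _ _
  -- let `j → ∞`
  by_contra hcon
  push Not at hcon
  have hpos : 0 < ‖ν n s‖ := hB0.trans_lt hcon
  obtain ⟨j, hj⟩ : ∃ j : ℕ, V * (p : ℝ)⁻¹ ^ j < ‖ν n s‖ := by
    rcases hV0.eq_or_lt with hV00 | hVpos
    · exact ⟨0, by rw [← hV00, zero_mul]; exact hpos⟩
    · obtain ⟨j, hj⟩ := exists_pow_lt_of_lt_one (div_pos hpos hVpos) (inv_lt_one_of_one_lt₀ hp1)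
      refine ⟨j, ?_⟩
      have := mul_lt_mul_of_pos_left hj hVpos
      rwa [mul_div_cancel₀ _ hVpos.ne'] at this
  exact absurd (key j n s) (not_le.mpr (max_lt hcon hj))

/-- **THE ISOMETRY AS A CERTIFICATE CRITERION.** For `μ` with the distribution relation and bounded orbit
sums, `RS k · → c_k`, `B ≥ 0`: SOME `‖c_k‖ > B` iff SOME orbit sum `‖ν_n(s)‖ > B` (with `B = p^{-(m+1)}` and a
`ℤ_p`-valued transform: «`μ`-invariant `≤ m`» ⟺ «some orbit sum `≢ 0 (mod p^{m+1})`») — NO bound on the cells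
enters. [cite: Washington1997, §7.1 and §12.2] [cite: MazurTateTeitelbaum1986Invent, §I.12–I.13] -/
theorem exists_lt_norm_lim_iff_exists_lt_norm_orbit
    (hdist : ∀ (n : ℕ) (a : ZMod (p ^ n)),
      ∑ b ∈ Finset.univ.filter (fun b : ZMod (p ^ (n + 1)) ↦
        ZMod.castHom (pow_dvd_pow p n.le_succ) (ZMod (p ^ n)) b = a), μ (n + 1) b = μ n a)
    {V : ℝ} (hV : ∀ (m : ℕ) (s : ZMod (p ^ m)), ‖ν m s‖ ≤ V)
    {c : ℕ → ℚ_[p]} (hc : ∀ k : ℕ, Tendsto (fun m ↦ RS k m) atTop (𝓝 (c k)))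
    {B : ℝ} (hB0 : 0 ≤ B) :
    (∃ k : ℕ, B < ‖c k‖) ↔ ∃ (n : ℕ) (s : ZMod (p ^ n)), B < ‖ν n s‖ := by
  constructor
  · rintro ⟨k, hk⟩
    by_contra hcon
    push Not at hcon
    exact absurd hk (not_lt.mpr (norm_lim_le_of_forall_norm_orbit_le hRS hν hB0 hcon (hc k)))
  · rintro ⟨n, s, hs⟩
    by_contra hcon
    push Not at hcon
    exact absurd hs (not_lt.mpr
      (norm_orbit_le_of_forall_norm_lim_le hRS hν hdist hV hc hB0 hcon n s))

end OrbitSup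

end Summit.BirchSwinnertonDyer.BirchSwinnertonDyer.Theorems.EisensteinPrimesX2OrbitSupNorm

end
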